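import Mathlib
import Summits.Ventures.PercRepro2.RootEdgeTheorems
import Summits.Ventures.PercRepro2.MinRowTyped

/-!
# The root-edge rows from the typed root-row count
(blind cell PercRepro2, night-3 g22, 2026-08-28; `proofs/NIGHT3-CERT.md` §31.8)

At a root edge `g = {a₁, v}` of an `a₃`-inactive instance g21 derived both weighted root-edge rows
from `Φ₁₁ ≤ M` (`Phi11_le_M_of_rootCross`, there obtained from `RootCross`).  `MinRowTyped.lean`
gives `Φ₁₁ ≤ M` at `g` from the typed root-row count `RootRowCount` at `g`
(`phi11_le_M_of_rootRowCount`; census: 0 negative on every abstract instance with ≤ 8 mixed edges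
besides `g`, kits j314082 / j314156), so the same two proofs give

* **`wrow23R_of_rootRowCount`**: `2 p_g² (1 − p_g) · Gc(p[g := 1]) ≤ T₂(p)`,
* **`wrowMinR_of_rootRowCount`**: `p_g (1 − p_g)² · Gc(p[g := 1]) ≤ T₁(p)`

at EVERY edge `g` of every `a₃`-inactive instance at which the typed root-row count holds (the
root-edge hypothesis of g21's proofs is not used; at root edges the count is census-true, at
`o`/`b`-edges it fails in general, as do these strengthened rows) — the second route to the root-edge
rows beside (3M) (`RootEdgeThreeMark.lean`).  The proofs are g21's verbatim, with `hM` supplied by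
the typed count.  Own work; standard axioms.
-/

namespace Summit.Ventures.PercRepro2

open UnionCluster

namespace CovForm

namespace RootEdge

open A3Inactive

variable {V : Type*} {E : Type*} [Fintype E] [DecidableEq E] [Fintype V] [DecidableEq V]
  {R : Type*} [Field R] [LinearOrder R] [IsStrictOrderedRing R]

/-- **The weighted (ROW-23-R) at ANY edge `g` of an `a₃`-inactive instance ⟸ the typed root-row count at `g`** (g21's root-edge proof with `Φ₁₁ ≤ M` from `phi11_le_M_of_rootRowCount`; the root-edge hypothesis is not used — at edges where `Φ₁₁ ≤ M` fails the count fails too):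
`2 p_g² (1 − p_g) · Gc(p[g := 1]) ≤ T₂(p)` — the type-2 Bernstein coefficient of the one-edge cubic
at `g = {a₁, v}` is at least TWICE the contraction (g20 §29.9b: 0 / 1,559,142 exhaustive typed rows),
from g20's row identity `wrow23_slack_of_a3Inactive`, `Gc_eq_of_a3Inactive` for the contraction,
`Q` decreasing, BHK 1.4 for the contraction, and `Φ₁₁ ≤ M` above. -/
theorem wrow23R_of_rootRowCount (ends : E → Sym2 V) (o a₁ a₂ a₃ b : V) (g : E)
    (hR : RootRowCount (R := R) ends o a₁ a₂ b g)
    (hinact : ∀ ω : Config E, ¬ Conn ends ω a₁ a₃ ∧ ¬ Conn ends ω a₂ a₃)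
    (p : E → R) (hp : IsProbVec p) (τ : E → ℕ) (hτ : τ g = 2) :
    2 * (p g ^ 2 * (1 - p g)) * Gc (Function.update p g 1) ends o a₁ a₂ a₃ b ≤
      triSum p {g} τ (K3 ends o a₁ a₂ a₃ b) := by
  have hid := wrow23_slack_of_a3Inactive p g τ hτ ends o a₁ a₂ a₃ b hinact
  have hG := Gc_eq_of_a3Inactive (Function.update p g 1) ends o a₁ a₂ a₃ b hinact
  have hM := phi11_le_M_of_rootRowCount hR p hp
  unfold bhkSlack mixedSlack at hM
  have hq := prob_Q_update_one_le p hp ends a₁ a₂ g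
  have hp1 : IsProbVec (Function.update p g 1) := hp.update g zero_le_one le_rfl
  have hΦ1 := bLoH_mul_Q_le (Function.update p g 1) hp1 ends o a₁ a₂ b
  have hΦ2 := bHoL_mul_Q_le (Function.update p g 1) hp1 ends o a₁ a₂ b
  have hQ1 := prob_nonneg hp1 (avoidAll ends a₂ {a₁})
  have hc : 0 ≤ 2 * (p g ^ 2 * (1 - p g)) :=
    mul_nonneg (by norm_num) (mul_nonneg (pow_nonneg (hp.nonneg g) 2)
      (sub_nonneg.mpr (hp.le_one g)))
  rw [← sub_nonneg, hG]
  have key : 0 ≤ triSum p {g} τ (K3 ends o a₁ a₂ a₃ b) -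
      2 * (p g ^ 2 * (1 - p g)) * Gc (Function.update p g 1) ends o a₁ a₂ a₃ b := by
    rw [hG]
    nlinarith [hid, hM, hq, hΦ1, hΦ2, hQ1, hc, mul_nonneg hc (mul_nonneg hQ1 (sub_nonneg.mpr hM)),
      mul_nonneg hc (mul_nonneg (sub_nonneg.mpr hq) (by linarith [hΦ1, hΦ2] :
        (0 : R) ≤ (prob (Function.update p g 1) (avoidAll ends a₂ {a₁} ∩ connEvent ends a₁ b) *
          prob (Function.update p g 1) (avoidAll ends a₂ {a₁} ∩ connEvent ends a₂ o) -
        prob (Function.update p g 1) (avoidAll ends a₂ {a₁}) *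
          prob (Function.update p g 1)
            (avoidAll ends a₂ {a₁} ∩ (connEvent ends a₂ o ∩ connEvent ends a₁ b))) +
        (prob (Function.update p g 1) (avoidAll ends a₂ {a₁} ∩ connEvent ends a₂ b) *
          prob (Function.update p g 1) (avoidAll ends a₂ {a₁} ∩ connEvent ends a₁ o) -
        prob (Function.update p g 1) (avoidAll ends a₂ {a₁}) *
          prob (Function.update p g 1)
            (avoidAll ends a₂ {a₁} ∩ (connEvent ends a₁ o ∩ connEvent ends a₂ b)))))]
  rw [hG] at key
  exact key

/-- **The weighted (ROW-MIN-R) at ANY edge `g` of an `a₃`-inactive instance ⟸ the typed root-row count at `g`** (g21's root-edge proof with `Φ₁₁ ≤ M` from `phi11_le_M_of_rootRowCount`):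
`p_g (1 − p_g)² · Gc(p[g := 1]) ≤ T₁(p)` — the type-1 Bernstein coefficient of the one-edge cubic at
`g = {a₁, v}` dominates the contraction (g20 §29.9: 0 / 7,491,265 exhaustive typed rows), from
g20's `wrow_one_of_a3Inactive`, `Gc_eq_of_a3Inactive`, `Q` decreasing, BHK 1.4 for the deletion
and `Φ₁₁ ≤ M` above. -/
theorem wrowMinR_of_rootRowCount (ends : E → Sym2 V) (o a₁ a₂ a₃ b : V) (g : E)
    (hR : RootRowCount (R := R) ends o a₁ a₂ b g)
    (hinact : ∀ ω : Config E, ¬ Conn ends ω a₁ a₃ ∧ ¬ Conn ends ω a₂ a₃)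
    (p : E → R) (hp : IsProbVec p) (τ : E → ℕ) (hτ : τ g = 1) :
    p g * (1 - p g) ^ 2 * Gc (Function.update p g 1) ends o a₁ a₂ a₃ b ≤
      triSum p {g} τ (K3 ends o a₁ a₂ a₃ b) := by
  have hid := wrow_one_of_a3Inactive p g τ hτ ends o a₁ a₂ a₃ b hinact
  have hG := Gc_eq_of_a3Inactive (Function.update p g 1) ends o a₁ a₂ a₃ b hinact
  have hM := phi11_le_M_of_rootRowCount hR p hp
  unfold bhkSlack mixedSlack at hM
  have hq := prob_Q_update_one_le p hp ends a₁ a₂ g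
  have hp1 : IsProbVec (Function.update p g 1) := hp.update g zero_le_one le_rfl
  have hp0 : IsProbVec (Function.update p g 0) := hp.update g le_rfl zero_le_one
  have hΦ1 := bLoH_mul_Q_le (Function.update p g 1) hp1 ends o a₁ a₂ b
  have hΦ2 := bHoL_mul_Q_le (Function.update p g 1) hp1 ends o a₁ a₂ b
  have hΦ01 := bLoH_mul_Q_le (Function.update p g 0) hp0 ends o a₁ a₂ b
  have hΦ02 := bHoL_mul_Q_le (Function.update p g 0) hp0 ends o a₁ a₂ b
  have hQ1 := prob_nonneg hp1 (avoidAll ends a₂ {a₁})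
  have hQ0 := prob_nonneg hp0 (avoidAll ends a₂ {a₁})
  have hc : 0 ≤ 2 * (p g * (1 - p g) ^ 2) :=
    mul_nonneg (by norm_num) (mul_nonneg (hp.nonneg g) (pow_nonneg (sub_nonneg.mpr (hp.le_one g)) 2))
  rw [← sub_nonneg, hG, hid]
  -- `T₁ − p(1−p)²·2q₁Φ₁₁ = 2p(1−p)²·[q₁Φ₀₀ + q₀M − q₁Φ₁₁]`, and the bracket is
  -- `q₁Φ₀₀ + (q₀ − q₁)M + q₁(M − Φ₁₁) ≥ 0`
  nlinarith [mul_nonneg hc (mul_nonneg hQ1 (by linarith [hΦ01, hΦ02] : (0 : R) ≤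
      (prob (Function.update p g 0) (avoidAll ends a₂ {a₁} ∩ connEvent ends a₁ b) *
          prob (Function.update p g 0) (avoidAll ends a₂ {a₁} ∩ connEvent ends a₂ o) -
        prob (Function.update p g 0) (avoidAll ends a₂ {a₁}) *
          prob (Function.update p g 0)
            (avoidAll ends a₂ {a₁} ∩ (connEvent ends a₂ o ∩ connEvent ends a₁ b))) +
        (prob (Function.update p g 0) (avoidAll ends a₂ {a₁} ∩ connEvent ends a₂ b) *
          prob (Function.update p g 0) (avoidAll ends a₂ {a₁} ∩ connEvent ends a₁ o) -
        prob (Function.update p g 0) (avoidAll ends a₂ {a₁}) *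
          prob (Function.update p g 0)
            (avoidAll ends a₂ {a₁} ∩ (connEvent ends a₁ o ∩ connEvent ends a₂ b))))),
    mul_nonneg hc (mul_nonneg (sub_nonneg.mpr hq) (by linarith [hM, hΦ1, hΦ2] : (0 : R) ≤
      (prob (Function.update p g 0) (avoidAll ends a₂ {a₁} ∩ connEvent ends a₁ b) *
          prob (Function.update p g 1) (avoidAll ends a₂ {a₁} ∩ connEvent ends a₂ o) +
        prob (Function.update p g 1) (avoidAll ends a₂ {a₁} ∩ connEvent ends a₁ b) *
          prob (Function.update p g 0) (avoidAll ends a₂ {a₁} ∩ connEvent ends a₂ o) +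
        prob (Function.update p g 0) (avoidAll ends a₂ {a₁} ∩ connEvent ends a₂ b) *
          prob (Function.update p g 1) (avoidAll ends a₂ {a₁} ∩ connEvent ends a₁ o) +
        prob (Function.update p g 1) (avoidAll ends a₂ {a₁} ∩ connEvent ends a₂ b) *
          prob (Function.update p g 0) (avoidAll ends a₂ {a₁} ∩ connEvent ends a₁ o)) -
      (prob (Function.update p g 0) (avoidAll ends a₂ {a₁}) *
          prob (Function.update p g 1)
            (avoidAll ends a₂ {a₁} ∩ (connEvent ends a₂ o ∩ connEvent ends a₁ b)) +
        prob (Function.update p g 1) (avoidAll ends a₂ {a₁}) *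
          prob (Function.update p g 0)
            (avoidAll ends a₂ {a₁} ∩ (connEvent ends a₂ o ∩ connEvent ends a₁ b)) +
        prob (Function.update p g 0) (avoidAll ends a₂ {a₁}) *
          prob (Function.update p g 1)
            (avoidAll ends a₂ {a₁} ∩ (connEvent ends a₁ o ∩ connEvent ends a₂ b)) +
        prob (Function.update p g 1) (avoidAll ends a₂ {a₁}) *
          prob (Function.update p g 0)
            (avoidAll ends a₂ {a₁} ∩ (connEvent ends a₁ o ∩ connEvent ends a₂ b))))),
    mul_nonneg hc (mul_nonneg hQ1 (sub_nonneg.mpr hM))]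

end RootEdge

end CovForm

end Summit.Ventures.PercRepro2
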